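import Summits.AtomisticToContinuum.FouriersLaw.Theorems.PhononMeanFreePathKuboFormFouriersLaw
import Summits.AtomisticToContinuum.FouriersLaw.Theorems.PhononMeanFreePathIncoherentBoundedWaypoint
import Summits.AtomisticToContinuum.FouriersLaw.Theses.JunctionLocality

/-!
# Channel bookkeeping for crux `IncoherentChannel`: what the crux alone forces on the route's other objects

Route `PhononMeanFreePath` (sub-problem `FouriersLaw`), crux `IncoherentChannel` (stmt-AtomisticToContinuum-11811),
line lead c3 of line `two-horizons-forecast-loss`; census file (`--supports`), nothing here closes an item.

For the `(N+1)`-site pinned anharmonic chain with both baths at `T` write (route Defs vocabulary)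
`C_N = powerCov`, `r_N = pairCorr`, and the three `N`-scaled sequences

* `kubo_N  = N(γ²/T²)∫₀^∞ C_N`            — the KUBO FORM (= BLR's response coefficient `D_{N+1}` by the proved
                                             `boundaryKubo_proof` + `NessUnique_holds`; `FouriersLaw ↔ ∃ κ > 0, kubo_N → κ`
                                             is the landed `fouriersLaw_iff_kuboForm`, p93864),
* `crux_N  = N(γ²/T²)∫₀^∞ (C_N − 2r_N²)`   — the crux's own sequence (`IncoherentChannel ↔ ∃ κ > 0, crux_N → κ`),
* `coh_N   = 2(γ²/T²)·N∫₀^∞ r_N²`          — the COHERENT (Landauer) channel (`CoherentDephasing ↔ N∫r_N² → 0`).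

Since `C_N` and `r_N²` are integrable at every fixed `N` (exponential mixing at fixed size), the EXACT BOOKKEEPING
`kubo_N = crux_N + coh_N` holds at every `N` with `coh_N ≥ 0` — landed for item 11815 as
`IncoherentBounded.kubo_eq_seq_add_coherent` / `IncoherentBounded.coherent_nonneg` (`…IncoherentBoundedWaypoint`), imported
here. This file draws the consequences FOR THE CRUX, all UNCONDITIONAL implications between named statements (the crux
is a HYPOTHESIS, never asserted):

* `kuboFloor_of_incoherentChannel` — `IncoherentChannel → ∀ params, ∃ c > 0, eventually c ≤ kubo_N`; hence
  `conductanceLowerBound_of_incoherentChannel : IncoherentChannel → ConductanceLowerBound` BY NAME (the open item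
  stmt-AtomisticToContinuum-11749, wanted by five routes): the conductance floor is NECESSARY for this crux.
* `coherentConverges_iff_fouriersLaw_of_incoherentChannel` — GIVEN the crux, `FouriersLaw ↔ (∀ params, ∃ c, coh_N → c)`:
  what the route's assembly really needs from its rank-2 crux once rank 3 is in hand is mere CONVERGENCE of the
  coherent channel (then `κ_Fourier = κ_crux + lim coh`), not its vanishing; `CoherentDephasing` is the case `c = 0`.
* `coherent_tendsto_of_incoherentChannel_of_fouriersLaw` — the `→` half with the sign: crux + Fourier ⇒ `coh_N → c ≥ 0`.

No definition, no `sorry`, axioms standard.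
-/

noncomputable section

open MeasureTheory Set Filter Topology
open scoped NNReal

namespace Summit.AtomisticToContinuum.FouriersLaw.Theorems.PhononMeanFreePath

open Literature.MathematicalPhysics.KineticTheory.HeatConduction
open Summit.AtomisticToContinuum.FouriersLaw.Theses.PhononMeanFreePath (IncoherentChannel NessUnique_holds)
open Summit.AtomisticToContinuum.FouriersLaw.Theorems.PhononMeanFreePathBoundaryKubo (boundaryKubo_proof)

/-! ## The crux sequence as printed -/

section FixedN

variable {ω₂ lam β γ T : ℝ}

/-- The crux's sequence in route-Defs vocabulary equals the sequence printed in `PhononMeanFreePath.IncoherentChannel`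
(definitional unfolding under the integral, `cruxIntegrand_eq`). [folklore] -/
theorem cruxSeq_eq_printed (N : ℕ) :
    (N : ℝ) * (γ ^ 2 / T ^ 2) * (∫ t in Ioi (0 : ℝ),
        (powerCov ω₂ lam β γ T N t - 2 * (pairCorr ω₂ lam β γ T N t) ^ 2)) =
      (N : ℝ) * (γ ^ 2 / T ^ 2) * ∫ t in Set.Ioi (0 : ℝ),
        ((∫ z, (z.2 0) ^ 2 * (∫ y, (y.2 (Fin.last N)) ^ 2
            ∂((pinnedChain ω₂ lam β γ).transitionKernel (N + 1) T T t.toNNReal z))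
            ∂((pinnedChain ω₂ lam β γ).gibbsMeasure (N + 1) T)) -
          (∫ z, (z.2 0) ^ 2 ∂((pinnedChain ω₂ lam β γ).gibbsMeasure (N + 1) T)) *
            (∫ z, (∫ y, (y.2 (Fin.last N)) ^ 2
              ∂((pinnedChain ω₂ lam β γ).transitionKernel (N + 1) T T t.toNNReal z))
              ∂((pinnedChain ω₂ lam β γ).gibbsMeasure (N + 1) T)) -
          2 * (∫ z, z.2 0 * (∫ y, y.2 (Fin.last N)
            ∂((pinnedChain ω₂ lam β γ).transitionKernel (N + 1) T T t.toNNReal z))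
            ∂((pinnedChain ω₂ lam β γ).gibbsMeasure (N + 1) T)) ^ 2) := by
  simp only [powerCov, pairCorr, fcast]

end FixedN

/-! ## Consequences of the crux for the Kubo form and the coherent channel -/

/-- **The crux forces a KUBO-FORM FLOOR:** if `IncoherentChannel` holds then at every parameter point there is
`c > 0` with `c ≤ N(γ²/T²)∫₀^∞ C_N` for all large `N` (`kubo_N = crux_N + coh_N ≥ crux_N → κ > 0`). [folklore] -/
theorem kuboFloor_of_incoherentChannel : Summit.AtomisticToContinuum.FouriersLaw.Theses.PhononMeanFreePath.IncoherentChannel → ∀ ω₂ lam β γ : ℝ, 0 < ω₂ → 0 < lam → 0 < β → 0 < γ → ∀ T : ℝ, 0 < T → ∃ c : ℝ, 0 < c ∧ ∀ᶠ N : ℕ in atTop, c ≤ (N : ℝ) * (γ ^ 2 / T ^ 2) * ∫ t in Ioi (0 : ℝ), powerCov ω₂ lam β γ T N t := by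
  intro h ω₂ lam β γ hω hl hβ hγ T hT
  obtain ⟨κ, hκ, hlim⟩ := h ω₂ lam β γ hω hl hβ hγ T hT
  refine ⟨κ / 2, half_pos hκ, ?_⟩
  have hev : ∀ᶠ N : ℕ in atTop, κ / 2 < (N : ℝ) * (γ ^ 2 / T ^ 2) * (∫ t in Ioi (0 : ℝ),
      (powerCov ω₂ lam β γ T N t - 2 * (pairCorr ω₂ lam β γ T N t) ^ 2)) := by
    have h' : Tendsto (fun N : ℕ => (N : ℝ) * (γ ^ 2 / T ^ 2) * (∫ t in Ioi (0 : ℝ),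
        (powerCov ω₂ lam β γ T N t - 2 * (pairCorr ω₂ lam β γ T N t) ^ 2))) atTop (𝓝 κ) := by
      refine hlim.congr' (Eventually.of_forall fun N => ?_)
      exact (cruxSeq_eq_printed (ω₂ := ω₂) (lam := lam) (β := β) (γ := γ) (T := T) N).symm
    exact h'.eventually (lt_mem_nhds (by linarith))
  filter_upwards [hev] with N hN
  rw [Summit.AtomisticToContinuum.FouriersLaw.Theorems.IncoherentBounded.kubo_eq_seq_add_coherent hω hl hβ hγ hT N]
  have h0 : 0 ≤ 2 * (γ ^ 2 / T ^ 2) * ((N : ℝ) * ∫ t in Ioi (0 : ℝ), (pairCorr ω₂ lam β γ T N t) ^ 2) :=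
    mul_nonneg (by positivity) (Summit.AtomisticToContinuum.FouriersLaw.Theorems.IncoherentBounded.coherent_nonneg (ω₂ := ω₂) (lam := lam) (β := β) (γ := γ) (T := T) N)
  linarith

/-- **`IncoherentChannel → ConductanceLowerBound` (item stmt-AtomisticToContinuum-11749, BY NAME):** along ANY steady-state
family with response coefficients `D_N`, the proved `boundaryKubo_proof` identifies `D_{N+1}` with the Kubo form
(`tendsto_nhds_unique` on the punctured-neighbourhood limit), and the Kubo-form floor gives `c ≤ D_N` for all large `N`.
So the conductance floor is a NECESSARY condition for this crux. [folklore] -/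
theorem conductanceLowerBound_of_incoherentChannel : Summit.AtomisticToContinuum.FouriersLaw.Theses.PhononMeanFreePath.IncoherentChannel → Summit.AtomisticToContinuum.FouriersLaw.Theses.JunctionLocality.ConductanceLowerBound := by
  intro h ω₂ lam β γ hω hl hβ hγ huniq μ hμ T hT D hD
  obtain ⟨c, hc, hev⟩ := kuboFloor_of_incoherentChannel h ω₂ lam β γ hω hl hβ hγ T hT
  have hKT := boundaryKubo_proof ω₂ lam β γ hω hl hβ hγ huniq μ hμ T hT
  have hDK : ∀ N : ℕ, D (N + 1) = (N : ℝ) * (γ ^ 2 / T ^ 2) * ∫ t in Ioi (0 : ℝ), powerCov ω₂ lam β γ T N t :=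
    fun N => tendsto_nhds_unique (hD (N + 1)) (hKT N).2
  obtain ⟨N₀, hN₀⟩ := eventually_atTop.1 hev
  refine ⟨c, hc, N₀ + 1, fun N hN => ?_⟩
  obtain ⟨M, rfl⟩ : ∃ M, N = M + 1 := ⟨N - 1, by omega⟩
  rw [hDK M]
  exact hN₀ M (by omega)

/-- **GIVEN the crux, Fourier's law is equivalent to CONVERGENCE of the coherent channel.** If `IncoherentChannel` holds,
then `FouriersLaw ↔ ∀ params, ∃ c, N∫₀^∞ r_N² → c`: (→) `coh_N = kubo_N − crux_N → κ_F − κ` by `fouriersLaw_iff_kuboForm`;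
(←) `kubo_N = crux_N + coh_N → κ + 2(γ²/T²)c > 0` (as `c ≥ 0`), which is the Kubo form of Fourier's law. [folklore] -/
theorem coherentConverges_iff_fouriersLaw_of_incoherentChannel : Summit.AtomisticToContinuum.FouriersLaw.Theses.PhononMeanFreePath.IncoherentChannel → (_root_.FouriersLaw ↔ (∀ ω₂ lam β γ : ℝ, 0 < ω₂ → 0 < lam → 0 < β → 0 < γ → ∀ T : ℝ, 0 < T → ∃ c : ℝ, Tendsto (fun N : ℕ => (N : ℝ) * ∫ t in Ioi (0 : ℝ), (pairCorr ω₂ lam β γ T N t) ^ 2) atTop (𝓝 c))) := by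
  intro h
  constructor
  · intro hF ω₂ lam β γ hω hl hβ hγ T hT
    obtain ⟨κF, -, hKubo⟩ := kuboForm_of_fouriersLaw hF ω₂ lam β γ hω hl hβ hγ T hT
    obtain ⟨κ, -, hcrux⟩ := h ω₂ lam β γ hω hl hβ hγ T hT
    have hcrux' : Tendsto (fun N : ℕ => (N : ℝ) * (γ ^ 2 / T ^ 2) * (∫ t in Ioi (0 : ℝ),
        (powerCov ω₂ lam β γ T N t - 2 * (pairCorr ω₂ lam β γ T N t) ^ 2))) atTop (𝓝 κ) :=
      hcrux.congr' (Eventually.of_forall fun N => (cruxSeq_eq_printed (ω₂ := ω₂) (lam := lam) (β := β) (γ := γ) (T := T) N).symm)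
    have hγT : (2 : ℝ) * (γ ^ 2 / T ^ 2) ≠ 0 := by positivity
    refine ⟨(κF - κ) / (2 * (γ ^ 2 / T ^ 2)), ?_⟩
    have hdiff := hKubo.sub hcrux'
    have key : ∀ N : ℕ, (N : ℝ) * ∫ t in Ioi (0 : ℝ), (pairCorr ω₂ lam β γ T N t) ^ 2 =
        ((N : ℝ) * (γ ^ 2 / T ^ 2) * (∫ t in Ioi (0 : ℝ), powerCov ω₂ lam β γ T N t) -
          (N : ℝ) * (γ ^ 2 / T ^ 2) * (∫ t in Ioi (0 : ℝ),
            (powerCov ω₂ lam β γ T N t - 2 * (pairCorr ω₂ lam β γ T N t) ^ 2))) / (2 * (γ ^ 2 / T ^ 2)) := by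
      intro N
      rw [Summit.AtomisticToContinuum.FouriersLaw.Theorems.IncoherentBounded.kubo_eq_seq_add_coherent hω hl hβ hγ hT N]
      field_simp
      ring
    simp_rw [key]
    exact hdiff.div_const _
  · intro hc
    refine fouriersLaw_of_kuboForm fun ω₂ lam β γ hω hl hβ hγ T hT => ?_
    obtain ⟨κ, hκ, hcrux⟩ := h ω₂ lam β γ hω hl hβ hγ T hT
    obtain ⟨c, hcoh⟩ := hc ω₂ lam β γ hω hl hβ hγ T hT
    have hc0 : 0 ≤ c := ge_of_tendsto' hcoh fun N => Summit.AtomisticToContinuum.FouriersLaw.Theorems.IncoherentBounded.coherent_nonneg (ω₂ := ω₂) (lam := lam) (β := β) (γ := γ) (T := T) N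
    have hcrux' : Tendsto (fun N : ℕ => (N : ℝ) * (γ ^ 2 / T ^ 2) * (∫ t in Ioi (0 : ℝ),
        (powerCov ω₂ lam β γ T N t - 2 * (pairCorr ω₂ lam β γ T N t) ^ 2))) atTop (𝓝 κ) :=
      hcrux.congr' (Eventually.of_forall fun N => (cruxSeq_eq_printed (ω₂ := ω₂) (lam := lam) (β := β) (γ := γ) (T := T) N).symm)
    refine ⟨κ + 2 * (γ ^ 2 / T ^ 2) * c, by positivity, ?_⟩
    have hsum := hcrux'.add (hcoh.const_mul (2 * (γ ^ 2 / T ^ 2)))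
    refine hsum.congr fun N => ?_
    exact (Summit.AtomisticToContinuum.FouriersLaw.Theorems.IncoherentBounded.kubo_eq_seq_add_coherent hω hl hβ hγ hT N).symm

/-- **Crux + Fourier ⇒ the coherent channel has a finite non-negative limit** (`coh`-limit `= κ_F − κ_crux ≥ 0`):
under both, the Landauer channel `N∫₀^∞ r_N²` is `O(1)` and convergent — `CoherentDephasing` is the case of limit `0`.
[folklore] -/
theorem coherent_tendsto_of_incoherentChannel_of_fouriersLaw : Summit.AtomisticToContinuum.FouriersLaw.Theses.PhononMeanFreePath.IncoherentChannel → _root_.FouriersLaw → ∀ ω₂ lam β γ : ℝ, 0 < ω₂ → 0 < lam → 0 < β → 0 < γ → ∀ T : ℝ, 0 < T → ∃ c : ℝ, 0 ≤ c ∧ Tendsto (fun N : ℕ => (N : ℝ) * ∫ t in Ioi (0 : ℝ), (pairCorr ω₂ lam β γ T N t) ^ 2) atTop (𝓝 c) := by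
  intro h hF ω₂ lam β γ hω hl hβ hγ T hT
  obtain ⟨c, hc⟩ := (coherentConverges_iff_fouriersLaw_of_incoherentChannel h).1 hF ω₂ lam β γ hω hl hβ hγ T hT
  exact ⟨c, ge_of_tendsto' hc fun N => Summit.AtomisticToContinuum.FouriersLaw.Theorems.IncoherentBounded.coherent_nonneg (ω₂ := ω₂) (lam := lam) (β := β) (γ := γ) (T := T) N, hc⟩

end Summit.AtomisticToContinuum.FouriersLaw.Theorems.PhononMeanFreePath

end
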